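import Summits.ValiantsHypothesis.ValiantsHypothesis.Theses.ProjectionRigidity
import Literature.Computability.AlgebraicComplexity.GrenetProjection

/-!
# Crux `ProjOptimalUnique` (stmt-ValiantsHypothesis-16001) — the TORIC strengthening is false at the optimal size

Negative lemma for the crux `ProjectionRigidity.ProjOptimalUnique` (disprover seat, cycle 1).
The crux asserts uniqueness of PURE optimal projections of `DET` with `det = per_n` (entries
`X v` or `C c`).  The natural strengthening to TORIC projections (entries `C c * X v` or `C c` — a
variable may carry a constant multiplier, e.g. a sign), `ProjOptimalUniqueToric`, is FALSE, already
at `n = 3` and at the optimal size `pdc(per₃) = 7`, with multipliers `±1` only.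

Witness.  `G` = Grenet's `7 × 7` matrix (rows/columns `s, u₀, u₁, u₂, v₀, v₁, v₂`) and its
one-column Koszul twist `T = G · (1 + D)`, `D = d · e_{u₀}ᵀ`, `d = (0, 0, X(2,0), −X(1,0), 0, 0, 0)ᵀ`
(the third basic syzygy of row `s`; `1 + D` is lower unitriangular, so `det T = det G = per₃`, the
latter through the unipotent factorisation `G · E₁ · E₂ =` upper triangular, as in the tree's
`GrenetRigidityOptimalUniqueThree_refuted`).  `T` has the two signed cells `(u₁,u₀) = X(2,0)`,
`(u₂,u₀) = −X(1,0)`; it is the disprover's reconstruction of the line lead's `TORIC-T`.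
Invariant: SIX variables of `G` (row `s` and column `s`) have a coefficient matrix with a single
non-zero row (rank `≤ 1`), but only FOUR variables of `T` do — the other five coefficient matrices
of `T` have an invertible `2 × 2` minor.  Every `γ ∈ permSymmetrySubst ℂ 3` is a monomial matrix
whose row map `v ↦ w(v)` is a BIJECTION of the nine variables (two proportional rows would make `γ`
singular), and `lin_v(P · G(γx) · Q) = P · (c • lin_{w(v)} G) · Q` (or transposed); pulling the six
rank-one variables of `G` back along the bijection gives six distinct variables of `T` of rank `≤ 1`
— an injection of a 6-set into a 4-set.

For provers: every uniqueness mechanism must use that variable coefficients are EXACTLY `1`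
(`T_c`, `c ∈ ℂˣ`, are even pairwise `GL × GL`-inequivalent); no constant gauge purifies any `T_c`
(disprover's `Disproof.lean`), while one extra vertex does (`WithoutOptimality`, size 8).
Monomiality/coefficient calculus adapted from `Theorems/GrenetRigidityOptimalUniqueRefutation.lean`.
-/

noncomputable section

-- single-conjunct layout: Sub = Summit, duplicated namespace component intended
set_option linter.dupNamespace false

namespace Summit.ValiantsHypothesis.ValiantsHypothesis.Theorems.ProjOptimalUnique.Negative

open MvPolynomial Matrix
open scoped Kronecker
open Literature.Computability.AlgebraicComplexity

/-- `ProjOptimalUnique` STRENGTHENED to toric projections: entries `C c * X v` or `C c` (a constant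
multiplier on each variable cell is allowed); size, group and conclusion verbatim. -/
def ProjOptimalUniqueToric : Prop :=
  ∀ n ≥ 3, ∀ A B : Matrix (Fin (detProjectionComplexity (perPoly (Fin n) ℂ)))
      (Fin (detProjectionComplexity (perPoly (Fin n) ℂ))) (MvPolynomial (Fin n × Fin n) ℂ),
    (∀ i j, (∃ (v : Fin n × Fin n) (c : ℂ), A i j = MvPolynomial.C c * MvPolynomial.X v) ∨
      ∃ c : ℂ, A i j = MvPolynomial.C c) →
    (∀ i j, (∃ (v : Fin n × Fin n) (c : ℂ), B i j = MvPolynomial.C c * MvPolynomial.X v) ∨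
      ∃ c : ℂ, B i j = MvPolynomial.C c) →
    A.det = perPoly (Fin n) ℂ → B.det = perPoly (Fin n) ℂ →
    ∃ (P Q : GL (Fin (detProjectionComplexity (perPoly (Fin n) ℂ))) ℂ) (γ : GL (Fin n × Fin n) ℂ),
      γ ∈ permSymmetrySubst ℂ n ∧
      (B = (P : Matrix _ _ ℂ).map MvPolynomial.C * Matrix.linSubstEntries γ A *
          (Q : Matrix _ _ ℂ).map MvPolynomial.C ∨
       B = (P : Matrix _ _ ℂ).map MvPolynomial.C * (Matrix.linSubstEntries γ A).transpose *
          (Q : Matrix _ _ ℂ).map MvPolynomial.C)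

set_option maxHeartbeats 1600000 in
/-- **The toric strengthening is false** (`n = 3`, size `pdc(per₃) = 7`): Grenet's `G` and its signed
one-column Koszul twist `T` are toric projections of `DET₇` with determinant `per₃` in different
`GL₇ × GL₇ × permSymmetrySubst × ᵀ` classes (six versus four rank-one variables). -/
theorem not_projOptimalUniqueToric : ¬ ProjOptimalUniqueToric := by
  intro hU
  have h3 := hU 3 le_rfl
  revert h3
  rw [detProjectionComplexity_perPoly_three]
  intro hU3
  -- ### the matrices
  obtain ⟨gA, hgA⟩ : ∃ M : Matrix (Fin 7) (Fin 7) (MvPolynomial (Fin 3 × Fin 3) ℂ), M =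
      !![0, X (0,0), X (1,0), X (2,0), 0, 0, 0;
         0, 1, 0, 0, 0, X (2,1), X (1,1);
         0, 0, 1, 0, X (2,1), 0, X (0,1);
         0, 0, 0, 1, X (1,1), X (0,1), 0;
         X (0,2), 0, 0, 0, 1, 0, 0;
         X (1,2), 0, 0, 0, 0, 1, 0;
         X (2,2), 0, 0, 0, 0, 0, 1] := ⟨_, rfl⟩
  obtain ⟨gT, hgT⟩ : ∃ M : Matrix (Fin 7) (Fin 7) (MvPolynomial (Fin 3 × Fin 3) ℂ), M =
      !![0, X (0,0), X (1,0), X (2,0), 0, 0, 0;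
         0, 1, 0, 0, 0, X (2,1), X (1,1);
         0, X (2,0), 1, 0, X (2,1), 0, X (0,1);
         0, -X (1,0), 0, 1, X (1,1), X (0,1), 0;
         X (0,2), 0, 0, 0, 1, 0, 0;
         X (1,2), 0, 0, 0, 0, 1, 0;
         X (2,2), 0, 0, 0, 0, 0, 1] := ⟨_, rfl⟩
  obtain ⟨E, hE⟩ : ∃ M : Matrix (Fin 7) (Fin 7) (MvPolynomial (Fin 3 × Fin 3) ℂ), M =
      !![1, 0, 0, 0, 0, 0, 0;
         0, 1, 0, 0, 0, 0, 0;
         0, X (2,0), 1, 0, 0, 0, 0;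
         0, -X (1,0), 0, 1, 0, 0, 0;
         0, 0, 0, 0, 1, 0, 0;
         0, 0, 0, 0, 0, 1, 0;
         0, 0, 0, 0, 0, 0, 1] := ⟨_, rfl⟩
  obtain ⟨E1, hE1⟩ : ∃ M : Matrix (Fin 7) (Fin 7) (MvPolynomial (Fin 3 × Fin 3) ℂ), M =
      !![1, 0, 0, 0, 0, 0, 0;
         0, 1, 0, 0, 0, -X (2,1), -X (1,1);
         0, 0, 1, 0, -X (2,1), 0, -X (0,1);
         0, 0, 0, 1, -X (1,1), -X (0,1), 0;
         0, 0, 0, 0, 1, 0, 0;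
         0, 0, 0, 0, 0, 1, 0;
         0, 0, 0, 0, 0, 0, 1] := ⟨_, rfl⟩
  obtain ⟨E2, hE2⟩ : ∃ M : Matrix (Fin 7) (Fin 7) (MvPolynomial (Fin 3 × Fin 3) ℂ), M =
      !![1, 0, 0, 0, 0, 0, 0;
         0, 1, 0, 0, 0, 0, 0;
         0, 0, 1, 0, 0, 0, 0;
         0, 0, 0, 1, 0, 0, 0;
         -X (0,2), 0, 0, 0, 1, 0, 0;
         -X (1,2), 0, 0, 0, 0, 1, 0;
         -X (2,2), 0, 0, 0, 0, 0, 1] := ⟨_, rfl⟩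
  obtain ⟨A1, hA1⟩ : ∃ M : Matrix (Fin 7) (Fin 7) (MvPolynomial (Fin 3 × Fin 3) ℂ), M =
      !![0, X (0,0), X (1,0), X (2,0), -(X (1,0) * X (2,1) + X (2,0) * X (1,1)),
           -(X (0,0) * X (2,1) + X (2,0) * X (0,1)), -(X (0,0) * X (1,1) + X (1,0) * X (0,1));
         0, 1, 0, 0, 0, 0, 0;
         0, 0, 1, 0, 0, 0, 0;
         0, 0, 0, 1, 0, 0, 0;
         X (0,2), 0, 0, 0, 1, 0, 0;
         X (1,2), 0, 0, 0, 0, 1, 0;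
         X (2,2), 0, 0, 0, 0, 0, 1] := ⟨_, rfl⟩
  obtain ⟨T7, hT7⟩ : ∃ M : Matrix (Fin 7) (Fin 7) (MvPolynomial (Fin 3 × Fin 3) ℂ), M =
      !![perPoly (Fin 3) ℂ, X (0,0), X (1,0), X (2,0), -(X (1,0) * X (2,1) + X (2,0) * X (1,1)),
           -(X (0,0) * X (2,1) + X (2,0) * X (0,1)), -(X (0,0) * X (1,1) + X (1,0) * X (0,1));
         0, 1, 0, 0, 0, 0, 0;
         0, 0, 1, 0, 0, 0, 0;
         0, 0, 0, 1, 0, 0, 0;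
         0, 0, 0, 0, 1, 0, 0;
         0, 0, 0, 0, 0, 1, 0;
         0, 0, 0, 0, 0, 0, 1] := ⟨_, rfl⟩
  have p3 : perPoly (Fin 3) ℂ = X (0,0) * (X (1,1) * X (2,2) + X (2,1) * X (1,2))
      + X (1,0) * (X (0,1) * X (2,2) + X (2,1) * X (0,2))
      + X (2,0) * (X (0,1) * X (1,2) + X (1,1) * X (0,2)) := by
    rw [perPoly, Matrix.permanent_fin_three_row]
    simp only [Matrix.mvPolynomialX_apply]
    ring
  have coeff_one_single : ∀ v : Fin 3 × Fin 3,
      (1 : MvPolynomial (Fin 3 × Fin 3) ℂ).coeff (Finsupp.single v 1) = 0 := fun v => by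
    rw [MvPolynomial.coeff_one, if_neg]
    exact Ne.symm (Finsupp.single_ne_zero.mpr one_ne_zero)
  -- ### ONE inspection of the 49 entries
  have big : ∀ i j : Fin 7,
      ((gA * E1) i j = A1 i j ∧ (A1 * E2) i j = T7 i j ∧ (gA * E) i j = gT i j) ∧
      ((j < i → E1 i j = 0) ∧ (j < i → T7 i j = 0) ∧ (i < j → E2 i j = 0) ∧ (i < j → E i j = 0)) ∧
      ((gA i j = 0 ∨ gA i j = 1 ∨ ∃ w, gA i j = X w) ∧
        (gT i j = 0 ∨ gT i j = 1 ∨ ∃ w, gT i j = X w ∨ gT i j = -X w)) ∧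
      (∀ w : Fin 3 × Fin 3, (gA i j).coeff (Finsupp.single w 1) ≠ 0 → w.2 ≠ 1 →
        i = ![![(0 : Fin 7), 0, 4], ![0, 0, 5], ![0, 0, 6]] w.1 w.2) := by
    intro i j
    rw [hgA, hgT, hE, hE1, hE2, hA1, hT7, p3]
    fin_cases i <;> fin_cases j <;> refine ⟨⟨?_, ?_, ?_⟩, ⟨?_, ?_, ?_, ?_⟩, ⟨?_, ?_⟩, ?_⟩ <;>
      simp [Matrix.mul_apply, Fin.sum_univ_seven, MvPolynomial.coeff_X, Finsupp.single_left_inj,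
        coeff_one_single]
    all_goals ring
  -- ### determinants and toric shape
  have det_gA : gA.det = perPoly (Fin 3) ℂ := by
    have h1 : gA * E1 = A1 := Matrix.ext fun i j => (big i j).1.1
    have h2 : A1 * E2 = T7 := Matrix.ext fun i j => (big i j).1.2.1
    have dE1 : E1.det = 1 := by
      rw [Matrix.det_of_upperTriangular (M := E1) fun i j hij => (big i j).2.1.1 hij,
        Fin.prod_univ_seven, hE1]; simp
    have dE2 : E2.det = 1 := by
      rw [Matrix.det_of_lowerTriangular E2 (fun i j hij => (big i j).2.1.2.2.1 hij),
        Fin.prod_univ_seven, hE2]; simp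
    have dT : T7.det = perPoly (Fin 3) ℂ := by
      rw [Matrix.det_of_upperTriangular (M := T7) fun i j hij => (big i j).2.1.2.1 hij,
        Fin.prod_univ_seven, hT7]; simp
    have h := congrArg Matrix.det h2
    rwa [← h1, Matrix.det_mul, Matrix.det_mul, dE1, dE2, dT, mul_one, mul_one] at h
  have det_gT : gT.det = perPoly (Fin 3) ℂ := by
    have h1 : gA * E = gT := Matrix.ext fun i j => (big i j).1.2.2
    have dE : E.det = 1 := by
      rw [Matrix.det_of_lowerTriangular E (fun i j hij => (big i j).2.1.2.2.2 hij),
        Fin.prod_univ_seven, hE]; simp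
    rw [← h1, Matrix.det_mul, det_gA, dE, mul_one]
  have toric_of_shape : ∀ {p : MvPolynomial (Fin 3 × Fin 3) ℂ},
      (p = 0 ∨ p = 1 ∨ ∃ w, p = X w ∨ p = -X w) → (∃ v c, p = C c * X v) ∨ ∃ c, p = C c := by
    rintro p (h | h | ⟨w, h | h⟩)
    · exact Or.inr ⟨0, by rw [h, map_zero]⟩
    · exact Or.inr ⟨1, by rw [h, map_one]⟩
    · exact Or.inl ⟨w, 1, by rw [h, map_one, one_mul]⟩
    · exact Or.inl ⟨w, -1, by rw [h, map_neg, map_one, neg_one_mul]⟩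
  have toric_gA : ∀ i j, (∃ v c, gA i j = C c * X v) ∨ ∃ c, gA i j = C c := fun i j =>
    toric_of_shape (by rcases (big i j).2.2.1.1 with h | h | ⟨w, h⟩ <;> simp [h])
  have toric_gT : ∀ i j, (∃ v c, gT i j = C c * X v) ∨ ∃ c, gT i j = C c := fun i j =>
    toric_of_shape (big i j).2.2.1.2
  -- ### every realised symmetry of `per₃` is a monomial substitution of the variables
  have rm_mul : ∀ {ι : Type} [Fintype ι] [DecidableEq ι] {M N : Matrix ι ι ℂ},
      (∀ i, ∃ (j : ι) (c : ℂ), ∀ j', M i j' = if j' = j then c else 0) →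
      (∀ i, ∃ (j : ι) (c : ℂ), ∀ j', N i j' = if j' = j then c else 0) →
      ∀ i, ∃ (j : ι) (c : ℂ), ∀ j', (M * N) i j' = if j' = j then c else 0 := by
    intro ι _ _ M N hM hN i
    obtain ⟨j, c, hj⟩ := hM i
    obtain ⟨l, d, hl⟩ := hN j
    refine ⟨l, c * d, fun j' => ?_⟩
    simp only [Matrix.mul_apply, hj, ite_mul, zero_mul, Finset.sum_ite_eq', Finset.mem_univ, if_true,
      hl, mul_ite, mul_zero]
  have rm_diag : ∀ {ι : Type} [DecidableEq ι] (d : ι → ℂ),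
      ∀ i, ∃ (j : ι) (c : ℂ), ∀ j', Matrix.diagonal d i j' = if j' = j then c else 0 := by
    intro ι _ d i
    refine ⟨i, d i, fun j' => ?_⟩
    by_cases h : j' = i
    · subst h; simp
    · simp [h, Matrix.diagonal_apply_ne _ (Ne.symm h)]
  have rm_perm : ∀ {ι : Type} [DecidableEq ι] (π : Equiv.Perm ι),
      ∀ i, ∃ (j : ι) (c : ℂ), ∀ j', π.permMatrix ℂ i j' = if j' = j then c else 0 := fun π i =>
    ⟨π i, 1, fun j' => by simp [Equiv.Perm.permMatrix, PEquiv.toMatrix_apply, Equiv.toPEquiv_apply, eq_comm]⟩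
  have inv_perm : ∀ {ι : Type} [Fintype ι] [DecidableEq ι] (π : Equiv.Perm ι),
      (π.permMatrix ℂ)⁻¹ = π⁻¹.permMatrix ℂ := by
    intro ι _ _ π
    apply Matrix.inv_eq_right_inv
    rw [← Matrix.permMatrix_mul, inv_mul_cancel, Matrix.permMatrix_one]
  have rm_kron : ∀ {ι κ : Type} [DecidableEq ι] [DecidableEq κ] {M : Matrix ι ι ℂ},
      (∀ i, ∃ (j : ι) (c : ℂ), ∀ j', M i j' = if j' = j then c else 0) →
      (∀ i, ∃ (j : ι × κ) (c : ℂ), ∀ j', (M ⊗ₖ (1 : Matrix κ κ ℂ)) i j' = if j' = j then c else 0) ∧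
      (∀ i, ∃ (j : κ × ι) (c : ℂ), ∀ j', ((1 : Matrix κ κ ℂ) ⊗ₖ M) i j' = if j' = j then c else 0) := by
    intro ι κ _ _ M hM
    constructor
    · rintro ⟨i, k⟩
      obtain ⟨j, c, hj⟩ := hM i
      refine ⟨(j, k), c, ?_⟩
      rintro ⟨j', k'⟩
      simp only [Matrix.kronecker_apply, hj, Matrix.one_apply, Prod.mk.injEq]
      by_cases h1 : j' = j <;> by_cases h2 : k = k' <;> simp [h1, h2, eq_comm]
    · rintro ⟨k, i⟩
      obtain ⟨j, c, hj⟩ := hM i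
      refine ⟨(k, j), c, ?_⟩
      rintro ⟨k', j'⟩
      simp only [Matrix.kronecker_apply, hj, Matrix.one_apply, Prod.mk.injEq]
      by_cases h1 : j' = j <;> by_cases h2 : k = k' <;> simp [h1, h2, eq_comm]
  have rm_mono : ∀ {m : ℕ} {g : GL (Fin m) ℂ}, g ∈ monomialSubgroup ℂ m →
      ∀ i, ∃ (j : Fin m) (c : ℂ), ∀ j', (g : Matrix (Fin m) (Fin m) ℂ) i j' = if j' = j then c else 0 := by
    intro m g hg
    induction hg using Subgroup.closure_induction'' with
    | mem x hx =>
      rcases hx with ⟨π, hπ⟩ | ⟨d, hd⟩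
      · rw [hπ]; exact rm_perm π
      · rw [hd]; exact rm_diag d
    | inv_mem x hx =>
      rcases hx with ⟨π, hπ⟩ | ⟨d, hd⟩
      · rw [Matrix.coe_units_inv, hπ, inv_perm]; exact rm_perm _
      · rw [Matrix.coe_units_inv, hd, Matrix.inv_diagonal]; exact rm_diag _
    | one => simpa using rm_diag (fun _ : Fin m => (1 : ℂ))
    | mul x y _ _ hx hy => rw [Units.val_mul]; exact rm_mul hx hy
  have hleft : ∀ {γ : GL (Fin 3 × Fin 3) ℂ}, γ ∈ leftMonomialSubst ℂ 3 →
      ∀ i, ∃ (j : Fin 3 × Fin 3) (c : ℂ), ∀ j',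
        (γ : Matrix (Fin 3 × Fin 3) (Fin 3 × Fin 3) ℂ) i j' = if j' = j then c else 0 := by
    intro γ hγ
    induction hγ using Subgroup.closure_induction'' with
    | mem x hx => obtain ⟨g, hg, hx⟩ := hx; rw [hx]; exact (rm_kron (rm_mono hg)).1
    | inv_mem x hx =>
      obtain ⟨g, hg, hx⟩ := hx
      rw [Matrix.coe_units_inv, hx, Matrix.inv_kronecker, inv_one, ← Matrix.coe_units_inv]
      exact (rm_kron (rm_mono (Subgroup.inv_mem _ hg))).1
    | one => simpa using rm_diag (fun _ : Fin 3 × Fin 3 => (1 : ℂ))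
    | mul x y _ _ hx hy => rw [Units.val_mul]; exact rm_mul hx hy
  have hright : ∀ {γ : GL (Fin 3 × Fin 3) ℂ}, γ ∈ rightMonomialSubst ℂ 3 →
      ∀ i, ∃ (j : Fin 3 × Fin 3) (c : ℂ), ∀ j',
        (γ : Matrix (Fin 3 × Fin 3) (Fin 3 × Fin 3) ℂ) i j' = if j' = j then c else 0 := by
    intro γ hγ
    induction hγ using Subgroup.closure_induction'' with
    | mem x hx => obtain ⟨g, hg, hx⟩ := hx; rw [hx]; exact (rm_kron (rm_mono hg)).2
    | inv_mem x hx =>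
      obtain ⟨g, hg, hx⟩ := hx
      rw [Matrix.coe_units_inv, hx, Matrix.inv_kronecker, inv_one, ← Matrix.coe_units_inv]
      exact (rm_kron (rm_mono (Subgroup.inv_mem _ hg))).2
    | one => simpa using rm_diag (fun _ : Fin 3 × Fin 3 => (1 : ℂ))
    | mul x y _ _ hx hy => rw [Units.val_mul]; exact rm_mul hx hy
  have rm_symm : ∀ {γ : GL (Fin 3 × Fin 3) ℂ}, γ ∈ permSymmetrySubst ℂ 3 →
      ∀ i, ∃ (j : Fin 3 × Fin 3) (c : ℂ), ∀ j',
        (γ : Matrix (Fin 3 × Fin 3) (Fin 3 × Fin 3) ℂ) i j' = if j' = j then c else 0 := by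
    intro γ hγ
    induction hγ using Subgroup.closure_induction'' with
    | mem x hx =>
      rcases hx with (hx | hx) | hx
      · exact hleft hx
      · exact hright hx
      · have hx' : (x : Matrix (Fin 3 × Fin 3) (Fin 3 × Fin 3) ℂ) =
            Equiv.Perm.permMatrix ℂ (Equiv.prodComm (Fin 3) (Fin 3)) := hx
        rw [hx']; exact rm_perm _
    | inv_mem x hx =>
      rcases hx with (hx | hx) | hx
      · exact hleft (Subgroup.inv_mem _ hx)
      · exact hright (Subgroup.inv_mem _ hx)
      · have hx' : (x : Matrix (Fin 3 × Fin 3) (Fin 3 × Fin 3) ℂ) =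
            Equiv.Perm.permMatrix ℂ (Equiv.prodComm (Fin 3) (Fin 3)) := hx
        rw [Matrix.coe_units_inv, hx', inv_perm]; exact rm_perm _
    | one => simpa using rm_diag (fun _ : Fin 3 × Fin 3 => (1 : ℂ))
    | mul x y _ _ hx hy => rw [Units.val_mul]; exact rm_mul hx hy
  -- ### linear parts
  obtain ⟨lin, hlin⟩ : ∃ f : Fin 3 × Fin 3 → Matrix (Fin 7) (Fin 7) (MvPolynomial (Fin 3 × Fin 3) ℂ) →
      Matrix (Fin 7) (Fin 7) ℂ, ∀ v M, f v M = Matrix.of fun i j => (M i j).coeff (Finsupp.single v 1) :=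
    ⟨_, fun _ _ => rfl⟩
  have lin_C_mul : ∀ v (P : Matrix (Fin 7) (Fin 7) ℂ) M, lin v (P.map C * M) = P * lin v M := by
    intro v P M
    apply Matrix.ext; intro i j
    simp [hlin, Matrix.mul_apply, MvPolynomial.coeff_sum, MvPolynomial.coeff_C_mul]
  have lin_mul_C : ∀ v M (Q : Matrix (Fin 7) (Fin 7) ℂ), lin v (M * Q.map C) = lin v M * Q := by
    intro v M Q
    apply Matrix.ext; intro i j
    have hc : ∀ (p : MvPolynomial (Fin 3 × Fin 3) ℂ) (a : ℂ),
        (p * C a).coeff (Finsupp.single v 1) = p.coeff (Finsupp.single v 1) * a := fun p a => by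
      rw [mul_comm, MvPolynomial.coeff_C_mul, mul_comm]
    simp [hlin, Matrix.mul_apply, MvPolynomial.coeff_sum, hc]
  have lin_transpose : ∀ v M, lin v Mᵀ = (lin v M)ᵀ := fun v M => by
    apply Matrix.ext; intro i j; simp [hlin]
  have lin_subst : ∀ (Γ : Matrix (Fin 3 × Fin 3) (Fin 3 × Fin 3) ℂ) (v : Fin 3 × Fin 3),
      lin v (gA.map (linSubst (Fin 3 × Fin 3) ℂ Γ)) = ∑ w, Γ v w • lin w gA := by
    intro Γ v
    apply Matrix.ext; intro i j
    simp only [hlin, Matrix.map_apply, Matrix.of_apply, Matrix.sum_apply, Matrix.smul_apply, smul_eq_mul]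
    rcases (big i j).2.2.1.1 with h | h | ⟨w, h⟩ <;> rw [h]
    · simp
    · simp [coeff_one_single]
    · simp [linSubst, MvPolynomial.coeff_sum, MvPolynomial.coeff_X, Finsupp.single_left_inj]
  -- ### rank at most one (a single non-zero row) versus an invertible 2 × 2 minor
  have rk_map : ∀ {N : Matrix (Fin 7) (Fin 7) ℂ} (P Q : Matrix (Fin 7) (Fin 7) ℂ) (c : ℂ),
      (∃ (U : Matrix (Fin 7) (Fin 1) ℂ) (V : Matrix (Fin 1) (Fin 7) ℂ), N = U * V) →
      (∃ (U : Matrix (Fin 7) (Fin 1) ℂ) (V : Matrix (Fin 1) (Fin 7) ℂ), P * (c • N) * Q = U * V) ∧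
      (∃ (U : Matrix (Fin 7) (Fin 1) ℂ) (V : Matrix (Fin 1) (Fin 7) ℂ), P * (c • N)ᵀ * Q = U * V) := by
    rintro N P Q c ⟨U, V, rfl⟩
    refine ⟨⟨P * (c • U), V * Q, ?_⟩, ⟨P * Vᵀ, (c • U)ᵀ * Q, ?_⟩⟩
    · rw [← Matrix.smul_mul, Matrix.mul_assoc, Matrix.mul_assoc, Matrix.mul_assoc]
    · rw [← Matrix.smul_mul, Matrix.transpose_mul, Matrix.mul_assoc, Matrix.mul_assoc, Matrix.mul_assoc]
  have rk_gA : ∀ w : Fin 3 × Fin 3, w.2 ≠ 1 →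
      ∃ (U : Matrix (Fin 7) (Fin 1) ℂ) (V : Matrix (Fin 1) (Fin 7) ℂ), lin w gA = U * V := by
    intro w hw
    refine ⟨Matrix.of fun i _ => if i = ![![(0 : Fin 7), 0, 4], ![0, 0, 5], ![0, 0, 6]] w.1 w.2 then 1 else 0,
      Matrix.of fun _ j => lin w gA (![![(0 : Fin 7), 0, 4], ![0, 0, 5], ![0, 0, 6]] w.1 w.2) j, ?_⟩
    apply Matrix.ext; intro i j
    simp only [Matrix.mul_apply, Fintype.sum_unique, Matrix.of_apply, ite_mul, one_mul, zero_mul]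
    split_ifs with h
    · rw [h]
    · rw [hlin, Matrix.of_apply]
      by_contra hne
      exact h ((big i j).2.2.2 w hne hw)
  have rk_gT : ∀ v : Fin 3 × Fin 3, v ∉ ({(0,0), (0,2), (1,2), (2,2)} : Finset (Fin 3 × Fin 3)) →
      ¬ ∃ (U : Matrix (Fin 7) (Fin 1) ℂ) (V : Matrix (Fin 1) (Fin 7) ℂ), lin v gT = U * V := by
    rintro v hv ⟨U, V, hUV⟩
    have minor0 : ∀ r c : Fin 2 → Fin 7, ((U * V).submatrix r c).det = 0 := fun r c => by
      simp [Matrix.det_fin_two, Matrix.mul_apply]; ring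
    have key : ∃ r c : Fin 2 → Fin 7, ((lin v gT).submatrix r c).det ≠ 0 := by
      rw [hlin, hgT]
      fin_cases v <;> simp at hv
      · exact ⟨![2, 3], ![6, 5], by simp [Matrix.det_fin_two, MvPolynomial.coeff_X]⟩
      · exact ⟨![0, 3], ![2, 1], by simp [Matrix.det_fin_two, MvPolynomial.coeff_X]⟩
      · exact ⟨![1, 3], ![6, 4], by simp [Matrix.det_fin_two, MvPolynomial.coeff_X]⟩
      · exact ⟨![0, 2], ![3, 1], by simp [Matrix.det_fin_two, MvPolynomial.coeff_X]⟩
      · exact ⟨![1, 2], ![5, 4], by simp [Matrix.det_fin_two, MvPolynomial.coeff_X]⟩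
    obtain ⟨r, c, hne⟩ := key
    exact hne (by rw [hUV]; exact minor0 r c)
  -- ### conclusion: the row map of `γ` is a bijection; pull back the six rank-one variables of `G`
  obtain ⟨P, Q, γ, hγ, hPQ⟩ := hU3 gA gT toric_gA toric_gT det_gA det_gT
  choose f cf hf using rm_symm hγ
  have f_inj : Function.Injective f := by
    intro v v' hvv'
    by_contra hne
    have hdet : (γ : Matrix (Fin 3 × Fin 3) (Fin 3 × Fin 3) ℂ).det = 0 := by
      by_cases hc : cf v = 0
      · exact Matrix.det_eq_zero_of_row_eq_zero v fun j' => by rw [hf v j']; simp [hc]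
      · rw [← Matrix.det_updateRow_add_smul_self (γ : Matrix _ _ ℂ) (Ne.symm hne) (-(cf v' / cf v))]
        refine Matrix.det_eq_zero_of_row_eq_zero v' fun j' => ?_
        simp only [Matrix.updateRow_self, Pi.add_apply, Pi.smul_apply, smul_eq_mul, hf v j', hf v' j',
          hvv']
        split_ifs <;> field_simp <;> ring
    exact (Matrix.isUnits_det_units γ).ne_zero hdet
  have f_surj : Function.Surjective f := Finite.surjective_of_injective f_inj
  have key : ∀ v, lin v gT = P * (cf v • lin (f v) gA) * Q ∨ lin v gT = P * (cf v • lin (f v) gA)ᵀ * Q := by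
    intro v
    have hsub : lin v (Matrix.linSubstEntries γ gA) = cf v • lin (f v) gA := by
      rw [Matrix.linSubstEntries, lin_subst]
      simp only [hf v, ite_smul, zero_smul, Finset.sum_ite_eq', Finset.mem_univ, if_true]
    rcases hPQ with hB | hB
    · left; rw [hB, lin_mul_C, lin_C_mul, hsub]
    · right; rw [hB, lin_mul_C, lin_C_mul, lin_transpose, hsub]
  have pull : ∀ v, (f v).2 ≠ 1 → v ∈ ({(0,0), (0,2), (1,2), (2,2)} : Finset (Fin 3 × Fin 3)) := by
    intro v hv
    by_contra hmem
    refine rk_gT v hmem ?_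
    rcases key v with h | h <;> rw [h]
    exacts [(rk_map P Q (cf v) (rk_gA (f v) hv)).1, (rk_map P Q (cf v) (rk_gA (f v) hv)).2]
  let e : (Fin 3 × Fin 3) ≃ (Fin 3 × Fin 3) := Equiv.ofBijective f ⟨f_inj, f_surj⟩
  have hS6 : ∀ w ∈ ({(0,0), (1,0), (2,0), (0,2), (1,2), (2,2)} : Finset (Fin 3 × Fin 3)), w.2 ≠ 1 := by
    decide
  have hcard := Finset.card_le_card_of_injOn (fun w => e.symm w)
    (s := ({(0,0), (1,0), (2,0), (0,2), (1,2), (2,2)} : Finset (Fin 3 × Fin 3)))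
    (t := ({(0,0), (0,2), (1,2), (2,2)} : Finset (Fin 3 × Fin 3)))
    (fun w hw => pull (e.symm w) (by
      rw [show f (e.symm w) = w from e.apply_symm_apply w]; exact hS6 w hw))
    (fun a _ b _ h => e.symm.injective h)
  revert hcard
  decide

end Summit.ValiantsHypothesis.ValiantsHypothesis.Theorems.ProjOptimalUnique.Negative

end
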